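import Literature.CategoryTheory.Preadditive.BichainCondition
import Literature.CategoryTheory.Preadditive.IndecomposableLocalEnd
import Literature.RingTheory.SimpleModule.LocalRingModuloRadical
import Mathlib.CategoryTheory.Abelian.Basic
import Mathlib.CategoryTheory.Endomorphism
import Mathlib.RingTheory.Nilpotent.Basic
import HarnessLib

/-!
# Fitting's lemma in an abelian category and «indecomposable ⟺ local endomorphism ring» for objects satisfying the bi-chain
# condition (Atiyah 1956, Lemmas 5–8; Krause 2015, Lemma 5.3 and Prop. 5.4)

Topic `Literature/CategoryTheory/Abelian`, namespace `Literature.CategoryTheory.KrullSchmidt`.  Third file of the CHAIN-CONDITIONS story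
(g41-#1 `Preadditive/BichainCondition`, g41-#2 `Abelian/BichainConditionFiniteLength`).  We follow Atiyah's Lemma 5 (which is Krause's
proof of Lemma 5.3): an endomorphism `φ` of `X` defines the bi-chain `Im φⁿ ↠ Im φⁿ⁺¹ ↣ Im φⁿ`; when it terminates, `φʳ` restricted to
`Im φʳ` is invertible and `X = Im φʳ ⊕ Ker φʳ`; for `X` indecomposable every endomorphism is then invertible or nilpotent, so `End X` is
local.  Everything proved; four auxiliary definitions with bodies (`powImageFwd`, `powImageBwd`, `powImageBichain`,
`isoPowImageBichainZero`), no named fact, no instance, no notation.  Endomorphisms are elements `φ : End X` of Mathlib's endomorphism ring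
(`f * g = g ≫ f`); the morphism underlying `φⁿ` is written `End.asHom (φ ^ n)`; `Im` is `Abelian.image` (= `kernel (cokernel.π _)`) with
`ιₙ = Abelian.image.ι`, `pₙ = Abelian.factorThruImage`, and `Ker` is `kernel`.

## The sources, verbatim

Krause [Krause2015KS, §5]: **Lemma 5.3 (Fitting).** «Let `X` be an object satisfying the bi-chain condition and `φ` an endomorphism.
(1) For large enough `r`, one has `X = Im φʳ ⊕ Ker φʳ`. (2) If `X` is indecomposable, then `φ` is either invertible or nilpotent.
*Proof.* The endomorphism `φ` yields a bi-chain `Xₙ —αₙ→ Xₙ₊₁ —βₙ→ Xₙ` (`n ≥ 0`) with `Xₙ = Im φⁿ`, `αₙ = φ`, and `βₙ` the inclusion. Because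
`X` satisfies the bi-chain condition, we may choose `r` large enough so that `Im φʳ = Im φʳ⁺¹`. Thus `φʳ : Im φʳ → Im φ²ʳ` is an isomorphism
and we denote by `ψ` its inverse. Furthermore, let `ι₁ : Im φʳ → X` and `ι₂ : Ker φʳ → X` denote the inclusions. We put
`π₁ = ψφʳ : X → Im φʳ` and `π₂ = id_X − ψφʳ : X → Ker φʳ`. Then `ι₁π₁ + ι₂π₂ = id_X` and `πᵢιᵢ = id_{Xᵢ}` for `i = 1, 2`. Thus
`X = Im φʳ ⊕ Ker φʳ`. Part (2) is an immediate consequence of (1).»  **Proposition 5.4.** «An object satisfying the bi-chain condition is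
indecomposable if and only if its endomorphism ring is local.  *Proof.* Let `X` be an indecomposable object and `φ, φ′` a pair of
endomorphisms. Suppose `φ + φ′` is invertible, say `ρ(φ + φ′) = id_X`. If `φ` is non-invertible then `ρφ` is non-invertible. Thus `ρφ` is
nilpotent, say `(ρφ)ʳ = 0`, by Lemma 5.3. We obtain `(id_X − ρφ)(id_X + ρφ + … + (ρφ)ʳ⁻¹) = id_X`. Therefore `ρφ′ = id_X − ρφ` is invertible
whence `φ′` is invertible. If `X = X₁ ⊕ X₂` with `Xᵢ ≠ 0` for `i = 1, 2`, then we have idempotent endomorphisms `εᵢ` of `X` with `Im εᵢ = Xᵢ`.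
Clearly, each `εᵢ` is non-invertible but `id_X = ε₁ + ε₂`.»
Atiyah [Atiyah1956, §4]: **Lemma 5.** «Let `A ∈ 𝔄`, and let `θ ∈ H(A,A)`. Then `θ` defines a bi-chain `{Aₙ, iₙ, pₙ}` of `𝔄`. Moreover, if this
bi-chain terminates, then for sufficiently large `n`, `Aₙ` is a direct factor of `A`.  *Proof.* … let `Im(θⁿ) = (Aₙ, jₙ)` where `jₙ : Aₙ → A`
is a monomorphism. Then there is a monomorphism `iₙ : Aₙ → Aₙ₋₁` such that `jₙ = i₁ i₂ … iₙ`. Also there exist epimorphisms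
`pₙ : Aₙ₋₁ → Aₙ`, defined by (1) `jₙ pₙ = θ jₙ₋₁`. We define the epimorphism `qₙ : A → Aₙ` by `qₙ = pₙ pₙ₋₁ … p₁`. … We assert that
`qₙ jₙ : Aₙ → Aₙ` is then an equivalence. In fact we have `qₙ jₙ = iₙ₊₁ iₙ₊₂ … i₂ₙ p₂ₙ … pₙ₊₁`; to show this it is sufficient to show equality
after premultiplying by the monomorphism `jₙ` … Put `qₙ jₙ = σₙ`, then `σₙ⁻¹` exists and we have `jₙ : Aₙ → A`, `σₙ⁻¹ qₙ : A → Aₙ` with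
`(σₙ⁻¹ qₙ) jₙ = e_{Aₙ}`. Hence `Aₙ` is a direct factor of `A`.»  **Lemma 6.** «Let the bi-chain condition hold in `𝔄`, and let `A ∈ 𝔄` be
indecomposable. Then every `θ ∈ H(A,A)` is either an equivalence or is nilpotent.»  **Lemma 7.** «… If `θ + φ = ω` where `θ, φ, ω ∈ H(A,A)`
and `ω` is an equivalence, then at least one of `θ, φ` is an equivalence.»  **Lemma 8.** «… If `∑_{s=1}^m θₛ = e_A`, where `θₛ ∈ H(A,A)`, then
at least one of the `θₛ` is an equivalence.»

## What is formalised (`C` abelian, `X : C`, `φ : End X`)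

* §1 `asHom_pow_succ` ∕ `asHom_pow_succ'` ∕ `asHom_pow_add` ∕ `asHom_pow_zero` (powers of an endomorphism as composites).
* §2 **the bi-chain of `φ`** (Atiyah Lemma 5, first half): `powImageFwd φ n : Im φⁿ ⟶ Im φⁿ⁺¹` (`αₙ`, the descent of `pₙ₊₁` along `pₙ`;
  epi; `pₙ ≫ αₙ = pₙ₊₁`, `αₙ ≫ ιₙ₊₁ = ιₙ ≫ φ` = Atiyah's (1)), `powImageBwd φ n : Im φⁿ⁺¹ ⟶ Im φⁿ` (`βₙ`, the lift of `ιₙ₊₁` along `ιₙ`;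
  mono; `βₙ ≫ ιₙ = ιₙ₊₁`), `powImageBichain φ : Bichain C`, and `isoPowImageBichainZero φ : X ≅ Im φ⁰`.
* §3 (Atiyah Lemma 5, second half) `ρₙ = αₙ ≫ βₙ` is `φ` restricted to `Im φⁿ` (`ρₙ ≫ ιₙ = ιₙ ≫ φ`, `ρₙᵏ ≫ ιₙ = ιₙ ≫ φᵏ`); **Atiyah's
  `σₙ = qₙ jₙ`: `ιₙ ≫ pₙ = ρₙⁿ`** (`ι_comp_factorThruImage_eq_pow`), hence invertible once `αₙ`, `βₙ` are (`isIso_ι_comp_factorThruImage`);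
  **`exists_iso_biprod_image_kernel_of_isIso`**: `σᵣ` invertible ⟹ `X ≅ Im φʳ ⊞ Ker φʳ` with `biprod.inl ≫ i.inv = image.ι (φʳ)` and
  `biprod.inr ≫ i.inv = kernel.ι (φʳ)` (Krause's `π₁ = pᵣ ≫ σᵣ⁻¹`, `π₂ =` the lift of `𝟙 − π₁ ≫ ιᵣ` to `Ker φʳ`, `ι₁π₁ + ι₂π₂ = 𝟙`,
  `πᵢιⱼ = δᵢⱼ`); `exists_iso_biprod_image_kernel_pow_of_eventuallyIso`; **FITTING'S LEMMA
  `BichainCondition.exists_iso_biprod_image_kernel_pow`**: for `X` satisfying the bi-chain condition and every `φ`, `X ≅ Im φʳ ⊞ Ker φʳ`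
  through the canonical monomorphisms for all large `r`; retract form `exists_retraction_image_kernel_pow`.
* §4 **Krause 5.3 (2) ∕ Atiyah Lemma 6** `BichainCondition.isIso_or_isNilpotent`: for `X` indecomposable, every `φ` is an isomorphism or
  nilpotent (`Im φʳ = 0 ⟹ φʳ = 0`; `Ker φʳ = 0 ⟹ φʳ` hence `φ` is mono, and bi-chain objects are co-Hopfian — g41-#1 `isIso_of_mono`);
  `isUnit_or_isNilpotent`.
* §5 **Prop. 5.4** `BichainCondition.isLocalRing_end` (indecomposable ⟹ `IsLocalRing (End X)`, through the tree's Lam (19.3)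
  `isLocalRing_of_forall_not_isUnit_isNilpotent`), **`BichainCondition.indecomposable_iff_isLocalRing_end`** (⟸ is the tree's
  `indecomposable_of_isLocalRing_end`, valid for every object); Atiyah's Lemmas 7–8 `exists_isIso_of_isIso_sum` (a sum of endomorphisms
  which is an isomorphism has an invertible summand; Mathlib `IsLocalRing.exists_of_isUnit_sum`).

NOT here: Atiyah's Theorem 1 ∕ Krause's Thm. 5.5 (existence of Remak decompositions and the Krull–Schmidt theorem) — next file; the
`φ`-stability of the two summands beyond what the canonical inclusions give.

## Mathlib ∕ Literature search

Mathlib: `Abelian.image`, `Abelian.image.ι`, `Abelian.factorThruImage`, `Abelian.image.fac`, `Abelian.epiDesc`∕`comp_epiDesc`,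
`Abelian.monoLift`∕`monoLift_comp`, `epi_of_epi_fac`, `mono_of_mono_fac`, `mono_of_mono`, `Abelian.mono_of_kernel_ι_eq_zero`, `kernel.lift`∕
`kernel.lift_ι`∕`kernel.condition`, `cokernel.condition`, `biprod.lift`∕`desc`∕`lift_desc`∕`hom_ext`∕`hom_ext'`, `isUnit_iff_isIso`,
`IsUnit.pow`, `IsLocalRing.exists_of_isUnit_sum`, `IsZero.eq_zero_of_src∕tgt`, `IsZero.iff_id_eq_zero`, `Indecomposable`; Mathlib has Fitting
only for modules (`LinearMap.eventually_isCompl_ker_pow_range_pow`), nothing for abelian categories (`rg -il fitting Mathlib/CategoryTheory`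
→ two unrelated docstrings).  Literature REUSED: g41-#1 (`Bichain`, `BichainCondition`, `isIso_of_mono`), `Preadditive/IndecomposableLocalEnd`
(`indecomposable_of_isLocalRing_end`), `RingTheory/SimpleModule/LocalRingModuloRadical` (`isLocalRing_of_forall_not_isUnit_isNilpotent`);
`Algebra/Module/FittingLemmaIndecomposable` (modules) and `Motives/MixedHodgeStructureIndecomposable*` (MHS) are other carriers, not restated.

## References

* M. Atiyah, *On the Krull-Schmidt theorem with application to sheaves*, Bull. Soc. Math. France 84 (1956) 307–317: §4 Lemmas 5, 6, 7, 8.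
  [Atiyah1956]
* H. Krause, *Krull–Schmidt categories and projective covers*, Expo. Math. 33 (2015) 535–549, arXiv:1410.2822: §5 Lemma 5.3, Prop. 5.4.
  [Krause2015KS]

## Provenance

Lane `lit-hodgefound` (summit `HodgeConjecture`, Track 2 foundations library), seat `lit-hodgefound-p36` (literature-prover, generation 41,
row g41-#3); Krause materialised as `paper-arxiv-1410.2822` (p0010), Atiyah as `galaxy-pdf-4113901900` (scan pp. 5–6 = pp. 311–312).
-/

open CategoryTheory CategoryTheory.Limits

namespace Literature.CategoryTheory.KrullSchmidt

universe v u

variable {C : Type u} [Category.{v} C]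

/-! ## §1 Powers of an endomorphism as composites

Endomorphisms are elements `φ : End X` of Mathlib's endomorphism monoid (`f * g = g ≫ f`); the morphism underlying `φⁿ` is written
`End.asHom (φ ^ n)`. -/

section Powers

variable {X : C} (φ : End X)

/-- `φⁿ⁺¹ = φ ≫ φⁿ` as morphisms. [cite: Atiyah1956, §4 Lemma 5 (proof)] -/
theorem asHom_pow_succ (n : ℕ) : End.asHom (φ ^ (n + 1)) = End.asHom φ ≫ End.asHom (φ ^ n) := by
  rw [pow_succ, End.mul_def]

/-- `φⁿ⁺¹ = φⁿ ≫ φ` as morphisms. [cite: Atiyah1956, §4 Lemma 5 (proof)] -/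
theorem asHom_pow_succ' (n : ℕ) : End.asHom (φ ^ (n + 1)) = End.asHom (φ ^ n) ≫ End.asHom φ := by
  rw [pow_succ', End.mul_def]

/-- `φᵐ⁺ⁿ = φᵐ ≫ φⁿ` as morphisms. [cite: Atiyah1956, §4 Lemma 5 (proof)] -/
theorem asHom_pow_add (m n : ℕ) : End.asHom (φ ^ (m + n)) = End.asHom (φ ^ m) ≫ End.asHom (φ ^ n) := by
  rw [add_comm, pow_add, End.mul_def]

/-- `φ⁰ = 𝟙`. [cite: Atiyah1956, §4 Lemma 5 (proof)] -/
theorem asHom_pow_zero : End.asHom (φ ^ 0) = 𝟙 X := by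
  rw [pow_zero, End.one_def]

end Powers

section Abelian

variable [Abelian C] {X : C} (φ : End X)

/-! ## §2 The bi-chain of an endomorphism: `Xₙ = Im φⁿ`, `αₙ = φ| : Im φⁿ ↠ Im φⁿ⁺¹`, `βₙ : Im φⁿ⁺¹ ↣ Im φⁿ` (Atiyah's Lemma 5)

Throughout, `Iₙ := Abelian.image (φⁿ)` with its monomorphism `ιₙ = Abelian.image.ι (φⁿ) : Iₙ ⟶ X` (Atiyah's `jₙ`) and epimorphism
`pₙ = Abelian.factorThruImage (φⁿ) : X ⟶ Iₙ` (Atiyah's `qₙ`), `pₙ ≫ ιₙ = φⁿ` (`Abelian.image.fac`). -/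

/-- `Ker pₙ` is killed by `φⁿ`. [cite: Atiyah1956, §4 Lemma 5 (proof)] -/
theorem kernel_ι_factorThruImage_comp_pow (n : ℕ) :
    kernel.ι (Abelian.factorThruImage (End.asHom (φ ^ n))) ≫ End.asHom (φ ^ n) = 0 :=
  calc _ = kernel.ι (Abelian.factorThruImage (End.asHom (φ ^ n))) ≫
        (Abelian.factorThruImage (End.asHom (φ ^ n)) ≫ Abelian.image.ι (End.asHom (φ ^ n))) := by rw [Abelian.image.fac]
    _ = 0 := by rw [kernel.condition_assoc, zero_comp]

/-- `φⁿ` is killed by `coker ιₙ`. [cite: Atiyah1956, §4 Lemma 5 (proof)] -/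
theorem pow_comp_cokernel_π_image_ι (n : ℕ) :
    End.asHom (φ ^ n) ≫ cokernel.π (Abelian.image.ι (End.asHom (φ ^ n))) = 0 :=
  calc _ = (Abelian.factorThruImage (End.asHom (φ ^ n)) ≫ Abelian.image.ι (End.asHom (φ ^ n))) ≫
        cokernel.π (Abelian.image.ι (End.asHom (φ ^ n))) := by rw [Abelian.image.fac]
    _ = 0 := by rw [Category.assoc, cokernel.condition, comp_zero]

/-- The epimorphism `αₙ : Iₙ ⟶ Iₙ₊₁` induced by `φ` (Krause's `αₙ = φ`; Atiyah's `pₙ₊₁`, «defined by `jₙ pₙ = θ jₙ₋₁`»): the descent of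
`pₙ₊₁` along the epimorphism `pₙ`. [cite: Krause2015KS, §5 Lemma 5.3 (proof)] [cite: Atiyah1956, §4 Lemma 5 (proof)] -/
noncomputable def powImageFwd (n : ℕ) : Abelian.image (End.asHom (φ ^ n)) ⟶ Abelian.image (End.asHom (φ ^ (n + 1))) :=
  Abelian.epiDesc (Abelian.factorThruImage (End.asHom (φ ^ n))) (Abelian.factorThruImage (End.asHom (φ ^ (n + 1)))) (by
    rw [← cancel_mono (Abelian.image.ι (End.asHom (φ ^ (n + 1)))), Category.assoc, Abelian.image.fac, zero_comp,
      asHom_pow_succ', ← Category.assoc, kernel_ι_factorThruImage_comp_pow, zero_comp])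

/-- `pₙ ≫ αₙ = pₙ₊₁`. [cite: Atiyah1956, §4 Lemma 5 (proof)] [cite: Krause2015KS, §5 Lemma 5.3 (proof)] -/
theorem factorThruImage_comp_powImageFwd (n : ℕ) :
    Abelian.factorThruImage (End.asHom (φ ^ n)) ≫ powImageFwd φ n = Abelian.factorThruImage (End.asHom (φ ^ (n + 1))) :=
  Abelian.comp_epiDesc _ _ _

/-- `αₙ` is an epimorphism. [cite: Atiyah1956, §4 Lemma 5 (proof)] [cite: Krause2015KS, §5 Lemma 5.3 (proof)] -/
theorem epi_powImageFwd (n : ℕ) : Epi (powImageFwd φ n) :=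
  epi_of_epi_fac (factorThruImage_comp_powImageFwd φ n)

/-- `αₙ ≫ ιₙ₊₁ = ιₙ ≫ φ` (Atiyah's (1): «`jₙ pₙ = θ jₙ₋₁`»). [cite: Atiyah1956, §4 Lemma 5 (1)] -/
theorem powImageFwd_comp_ι (n : ℕ) :
    powImageFwd φ n ≫ Abelian.image.ι (End.asHom (φ ^ (n + 1))) = Abelian.image.ι (End.asHom (φ ^ n)) ≫ End.asHom φ := by
  rw [← cancel_epi (Abelian.factorThruImage (End.asHom (φ ^ n))), ← Category.assoc, factorThruImage_comp_powImageFwd,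
    Abelian.image.fac, ← Category.assoc, Abelian.image.fac, asHom_pow_succ']

/-- The monomorphism `βₙ : Iₙ₊₁ ⟶ Iₙ`, the inclusion `Im φⁿ⁺¹ ⊆ Im φⁿ` (Krause's `βₙ`; Atiyah's `iₙ₊₁`, «`jₙ = i₁ i₂ … iₙ`»): the lift of
`ιₙ₊₁` along the monomorphism `ιₙ`. [cite: Krause2015KS, §5 Lemma 5.3 (proof)] [cite: Atiyah1956, §4 Lemma 5 (proof)] -/
noncomputable def powImageBwd (n : ℕ) : Abelian.image (End.asHom (φ ^ (n + 1))) ⟶ Abelian.image (End.asHom (φ ^ n)) :=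
  Abelian.monoLift (Abelian.image.ι (End.asHom (φ ^ n))) (Abelian.image.ι (End.asHom (φ ^ (n + 1)))) (by
    rw [← cancel_epi (Abelian.factorThruImage (End.asHom (φ ^ (n + 1)))), ← Category.assoc, Abelian.image.fac, comp_zero,
      asHom_pow_succ, Category.assoc, pow_comp_cokernel_π_image_ι, comp_zero])

/-- `βₙ ≫ ιₙ = ιₙ₊₁`. [cite: Atiyah1956, §4 Lemma 5 (proof)] [cite: Krause2015KS, §5 Lemma 5.3 (proof)] -/
theorem powImageBwd_comp_ι (n : ℕ) :
    powImageBwd φ n ≫ Abelian.image.ι (End.asHom (φ ^ n)) = Abelian.image.ι (End.asHom (φ ^ (n + 1))) :=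
  Abelian.monoLift_comp _ _ _

/-- `βₙ` is a monomorphism. [cite: Atiyah1956, §4 Lemma 5 (proof)] [cite: Krause2015KS, §5 Lemma 5.3 (proof)] -/
theorem mono_powImageBwd (n : ℕ) : Mono (powImageBwd φ n) :=
  mono_of_mono_fac (powImageBwd_comp_ι φ n)

/-- **The bi-chain of an endomorphism** (Atiyah's Lemma 5: «Let `A ∈ 𝔄`, and let `θ ∈ H(A,A)`. Then `θ` defines a bi-chain `{Aₙ, iₙ, pₙ}` of
`𝔄`»; Krause: «The endomorphism `φ` yields a bi-chain … with `Xₙ = Im φⁿ`, `αₙ = φ`, and `βₙ` the inclusion»). [cite: Atiyah1956, §4 Lemma 5]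
[cite: Krause2015KS, §5 Lemma 5.3 (proof)] -/
noncomputable def powImageBichain : Bichain C where
  obj n := Abelian.image (End.asHom (φ ^ n))
  fwd n := powImageFwd φ n
  bwd n := powImageBwd φ n
  epi_fwd n := epi_powImageFwd φ n
  mono_bwd n := mono_powImageBwd φ n

/-- The objects of the bi-chain of `φ` are the images `Im φⁿ`. [cite: Atiyah1956, §4 Lemma 5] -/
theorem powImageBichain_obj (n : ℕ) : (powImageBichain φ).obj n = Abelian.image (End.asHom (φ ^ n)) := rfl

/-- Its epimorphisms are the `αₙ`. [cite: Atiyah1956, §4 Lemma 5] -/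
theorem powImageBichain_fwd (n : ℕ) : (powImageBichain φ).fwd n = powImageFwd φ n := rfl

/-- Its monomorphisms are the `βₙ`. [cite: Atiyah1956, §4 Lemma 5] -/
theorem powImageBichain_bwd (n : ℕ) : (powImageBichain φ).bwd n = powImageBwd φ n := rfl

/-- `p₀ : X ⟶ Im φ⁰ = Im 𝟙` is an isomorphism, so the bi-chain of `φ` starts at (an object isomorphic to) `X`. [cite: Atiyah1956, §4 Lemma 5] -/
theorem isIso_factorThruImage_pow_zero : IsIso (Abelian.factorThruImage (End.asHom (φ ^ 0))) := by
  haveI : IsSplitMono (Abelian.factorThruImage (End.asHom (φ ^ 0))) :=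
    IsSplitMono.mk' ⟨Abelian.image.ι (End.asHom (φ ^ 0)), by rw [Abelian.image.fac, asHom_pow_zero]⟩
  exact isIso_of_epi_of_isSplitMono _

/-- The isomorphism `X ≅ Im φ⁰` placing `X` at the start of the bi-chain of `φ`. [cite: Atiyah1956, §4 Lemma 5] -/
noncomputable def isoPowImageBichainZero : X ≅ (powImageBichain φ).obj 0 :=
  @asIso _ _ _ _ (Abelian.factorThruImage (End.asHom (φ ^ 0))) (isIso_factorThruImage_pow_zero φ)

/-! ## §3 If the bi-chain of `φ` terminates, `Im φʳ` is a direct summand complementary to `Ker φʳ` (Atiyah's Lemma 5, Krause's 5.3 (1)) -/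

/-- `φ` restricted to `Im φⁿ`: `ρₙ := αₙ ≫ βₙ : Iₙ ⟶ Iₙ` satisfies `ρₙ ≫ ιₙ = ιₙ ≫ φ`. [cite: Atiyah1956, §4 Lemma 5 (proof)] -/
theorem powImageFwd_comp_powImageBwd_comp_ι (n : ℕ) :
    (powImageFwd φ n ≫ powImageBwd φ n) ≫ Abelian.image.ι (End.asHom (φ ^ n)) = Abelian.image.ι (End.asHom (φ ^ n)) ≫ End.asHom φ := by
  rw [Category.assoc, powImageBwd_comp_ι, powImageFwd_comp_ι]

/-- Hence `ρₙᵏ ≫ ιₙ = ιₙ ≫ φᵏ` for all `k`. [cite: Atiyah1956, §4 Lemma 5 (proof)] -/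
theorem pow_restrict_comp_ι (n k : ℕ) :
    End.asHom ((End.of (powImageFwd φ n ≫ powImageBwd φ n)) ^ k) ≫ Abelian.image.ι (End.asHom (φ ^ n)) =
      Abelian.image.ι (End.asHom (φ ^ n)) ≫ End.asHom (φ ^ k) := by
  induction k with
  | zero => rw [asHom_pow_zero, asHom_pow_zero, Category.id_comp, Category.comp_id]
  | succ k ih =>
    rw [asHom_pow_succ', Category.assoc]
    change End.asHom (End.of (powImageFwd φ n ≫ powImageBwd φ n) ^ k) ≫ (powImageFwd φ n ≫ powImageBwd φ n) ≫ _ = _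
    rw [powImageFwd_comp_powImageBwd_comp_ι, ← Category.assoc, ih, Category.assoc, ← asHom_pow_succ']

/-- Atiyah's `σₙ = qₙ jₙ`: the endomorphism `ιₙ ≫ pₙ` of `Iₙ = Im φⁿ` («`θⁿ` on `Im θⁿ`») is the `n`-th power of `ρₙ = φ|_{Iₙ}` (Atiyah:
«`qₙ jₙ = iₙ₊₁ iₙ₊₂ … i₂ₙ p₂ₙ … pₙ₊₁`; to show this it is sufficient to show equality after premultiplying by the monomorphism `jₙ`»).
[cite: Atiyah1956, §4 Lemma 5 (proof)] -/
theorem ι_comp_factorThruImage_eq_pow (n : ℕ) :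
    Abelian.image.ι (End.asHom (φ ^ n)) ≫ Abelian.factorThruImage (End.asHom (φ ^ n)) =
      End.asHom ((End.of (powImageFwd φ n ≫ powImageBwd φ n)) ^ n) := by
  rw [← cancel_mono (Abelian.image.ι (End.asHom (φ ^ n))), Category.assoc, Abelian.image.fac]
  exact (pow_restrict_comp_ι φ n n).symm

/-- If `αₙ` and `βₙ` are invertible then `σₙ = ιₙ ≫ pₙ` is invertible («Put `qₙ jₙ = σₙ`, then `σₙ⁻¹` exists»). [cite: Atiyah1956, §4 Lemma 5 (proof)] -/
theorem isIso_ι_comp_factorThruImage (n : ℕ) [IsIso (powImageFwd φ n)] [IsIso (powImageBwd φ n)] :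
    IsIso (Abelian.image.ι (End.asHom (φ ^ n)) ≫ Abelian.factorThruImage (End.asHom (φ ^ n))) := by
  rw [ι_comp_factorThruImage_eq_pow]
  have hu : IsUnit (End.of (powImageFwd φ n ≫ powImageBwd φ n)) := (isUnit_iff_isIso _).2 (by
    change IsIso (powImageFwd φ n ≫ powImageBwd φ n)
    infer_instance)
  exact (isUnit_iff_isIso _).1 (hu.pow n)

/-- **Atiyah's Lemma 5 ∕ the heart of Fitting's lemma**: if `σᵣ = ιᵣ ≫ pᵣ : Im φʳ ⟶ Im φʳ` is invertible, then
`X ≅ Im φʳ ⊞ Ker φʳ`, the summands embedded by `ιᵣ = image.ι (φʳ)` and `kernel.ι (φʳ)` (Atiyah: «`jₙ : Aₙ → A`, `σₙ⁻¹ qₙ : A → Aₙ` with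
`(σₙ⁻¹ qₙ) jₙ = e_{Aₙ}`. Hence `Aₙ` is a direct factor of `A`»; Krause: «We put `π₁ = ψ φʳ : X → Im φʳ` and `π₂ = id_X − ψ φʳ : X → Ker φʳ`.
Then `ι₁ π₁ + ι₂ π₂ = id_X` and `πᵢ ιᵢ = id_{Xᵢ}` for `i = 1, 2`. Thus `X = Im φʳ ⊕ Ker φʳ`»).  Here `π₁ = pᵣ ≫ σᵣ⁻¹` and `π₂` is the lift of
`𝟙 − π₁ ≫ ιᵣ` to the kernel. [cite: Krause2015KS, §5 Lemma 5.3 (1) (proof)] [cite: Atiyah1956, §4 Lemma 5] -/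
theorem exists_iso_biprod_image_kernel_of_isIso (r : ℕ)
    [IsIso (Abelian.image.ι (End.asHom (φ ^ r)) ≫ Abelian.factorThruImage (End.asHom (φ ^ r)))] :
    ∃ i : X ≅ Abelian.image (End.asHom (φ ^ r)) ⊞ kernel (End.asHom (φ ^ r)),
      biprod.inl ≫ i.inv = Abelian.image.ι (End.asHom (φ ^ r)) ∧ biprod.inr ≫ i.inv = kernel.ι (End.asHom (φ ^ r)) := by
  -- notation
  set f : X ⟶ X := End.asHom (φ ^ r) with hf
  set ι₁ := Abelian.image.ι f with hι₁
  set p := Abelian.factorThruImage f with hp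
  set σ := ι₁ ≫ p with hσ
  have hpι : p ≫ ι₁ = f := Abelian.image.fac _
  set π₁ : X ⟶ Abelian.image f := p ≫ inv σ with hπ₁
  have h11 : ι₁ ≫ π₁ = 𝟙 _ := by rw [hπ₁, ← Category.assoc, ← hσ, IsIso.hom_inv_id]
  -- the idempotent `e = π₁ ≫ ι₁` and its complement
  have hι₁f : ι₁ ≫ f = σ ≫ ι₁ := by rw [hσ, Category.assoc, hpι]
  have he : (𝟙 X - π₁ ≫ ι₁) ≫ f = 0 := by
    rw [Preadditive.sub_comp, Category.id_comp, hπ₁, Category.assoc, Category.assoc, hι₁f, IsIso.inv_hom_id_assoc, hpι, sub_self]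
  set π₂ : X ⟶ kernel f := kernel.lift f (𝟙 X - π₁ ≫ ι₁) he with hπ₂
  have hπ₂ι : π₂ ≫ kernel.ι f = 𝟙 X - π₁ ≫ ι₁ := kernel.lift_ι _ _ _
  have hkp : kernel.ι f ≫ p = 0 := by
    rw [← cancel_mono ι₁, Category.assoc, hpι, kernel.condition, zero_comp]
  have h21 : kernel.ι f ≫ π₁ = 0 := by rw [hπ₁, ← Category.assoc, hkp, zero_comp]
  have h22 : kernel.ι f ≫ π₂ = 𝟙 _ := by
    rw [← cancel_mono (kernel.ι f), Category.assoc, hπ₂ι, Preadditive.comp_sub, Category.comp_id, ← Category.assoc, h21,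
      zero_comp, sub_zero, Category.id_comp]
  have h12 : ι₁ ≫ π₂ = 0 := by
    rw [← cancel_mono (kernel.ι f), Category.assoc, hπ₂ι, Preadditive.comp_sub, Category.comp_id, ← Category.assoc, h11,
      Category.id_comp, sub_self, zero_comp]
  have htot : π₁ ≫ ι₁ + π₂ ≫ kernel.ι f = 𝟙 X := by rw [hπ₂ι]; abel
  refine ⟨⟨biprod.lift π₁ π₂, biprod.desc ι₁ (kernel.ι f), by rw [biprod.lift_desc, htot], ?_⟩, ?_, ?_⟩
  · apply biprod.hom_ext' <;> apply biprod.hom_ext <;> simp [h11, h12, h21, h22]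
  · simp
  · simp

/-- **Atiyah's Lemma 5, second half**: «if this bi-chain terminates, then for sufficiently large `n`, `Aₙ` is a direct factor of `A`» — if the
bi-chain of `φ` terminates then `X ≅ Im φʳ ⊞ Ker φʳ` for all large `r`. [cite: Atiyah1956, §4 Lemma 5] [cite: Krause2015KS, §5 Lemma 5.3 (1) (proof)] -/
theorem exists_iso_biprod_image_kernel_pow_of_eventuallyIso (h : (powImageBichain φ).EventuallyIso) :
    ∃ r₀ : ℕ, ∀ r, r₀ ≤ r → ∃ i : X ≅ Abelian.image (End.asHom (φ ^ r)) ⊞ kernel (End.asHom (φ ^ r)),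
      biprod.inl ≫ i.inv = Abelian.image.ι (End.asHom (φ ^ r)) ∧ biprod.inr ≫ i.inv = kernel.ι (End.asHom (φ ^ r)) := by
  obtain ⟨n₀, hn₀⟩ := h
  refine ⟨n₀, fun r hr => ?_⟩
  obtain ⟨h1, h2⟩ := hn₀ r hr
  haveI : IsIso (powImageFwd φ r) := h1
  haveI : IsIso (powImageBwd φ r) := h2
  haveI := isIso_ι_comp_factorThruImage φ r
  exact exists_iso_biprod_image_kernel_of_isIso φ r

/-- **Fitting's lemma (Krause 5.3 (1), Atiyah Lemma 5) for objects satisfying the bi-chain condition.** «Let `X` be an object satisfying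
the bi-chain condition and `φ` an endomorphism. For large enough `r`, one has `X = Im φʳ ⊕ Ker φʳ`»: there is `r₀` such that for every
`r ≥ r₀` the canonical morphisms `image.ι (φʳ)`, `kernel.ι (φʳ)` are the inclusions of a biproduct decomposition
`X ≅ Im φʳ ⊞ Ker φʳ`. [cite: Krause2015KS, §5 Lemma 5.3 (1)] [cite: Atiyah1956, §4 Lemma 5] -/
theorem BichainCondition.exists_iso_biprod_image_kernel_pow (hX : BichainCondition X) (φ : End X) :
    ∃ r₀ : ℕ, ∀ r, r₀ ≤ r → ∃ i : X ≅ Abelian.image (End.asHom (φ ^ r)) ⊞ kernel (End.asHom (φ ^ r)),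
      biprod.inl ≫ i.inv = Abelian.image.ι (End.asHom (φ ^ r)) ∧ biprod.inr ≫ i.inv = kernel.ι (End.asHom (φ ^ r)) :=
  exists_iso_biprod_image_kernel_pow_of_eventuallyIso φ (hX (powImageBichain φ) ⟨isoPowImageBichainZero φ⟩)

/-- Retract form (Atiyah: «for sufficiently large `n`, `Aₙ` is a direct factor of `A`»): for large `r`, `Im φʳ` and `Ker φʳ` are retracts of
`X` through their canonical monomorphisms. [cite: Atiyah1956, §4 Lemma 5] [cite: Krause2015KS, §5 Lemma 5.3 (1)] -/
theorem BichainCondition.exists_retraction_image_kernel_pow (hX : BichainCondition X) (φ : End X) :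
    ∃ r₀ : ℕ, ∀ r, r₀ ≤ r →
      (∃ π : X ⟶ Abelian.image (End.asHom (φ ^ r)), Abelian.image.ι (End.asHom (φ ^ r)) ≫ π = 𝟙 _) ∧
        ∃ π : X ⟶ kernel (End.asHom (φ ^ r)), kernel.ι (End.asHom (φ ^ r)) ≫ π = 𝟙 _ := by
  obtain ⟨r₀, hr₀⟩ := hX.exists_iso_biprod_image_kernel_pow φ
  refine ⟨r₀, fun r hr => ?_⟩
  obtain ⟨i, hinl, hinr⟩ := hr₀ r hr
  exact ⟨⟨i.hom ≫ biprod.fst, by rw [← hinl, Category.assoc, i.inv_hom_id_assoc, biprod.inl_fst]⟩,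
    ⟨i.hom ≫ biprod.snd, by rw [← hinr, Category.assoc, i.inv_hom_id_assoc, biprod.inr_snd]⟩⟩

/-! ## §4 Indecomposable objects: every endomorphism is invertible or nilpotent (Atiyah Lemma 6, Krause 5.3 (2)) -/

/-- **Krause 5.3 (2) ∕ Atiyah's Lemma 6.** «If `X` is indecomposable, then `φ` is either invertible or nilpotent» (for `X` satisfying the
bi-chain condition; Atiyah: «either `jₙ` and `qₙ` are equivalences or they are zero. In the former case this means that `θⁿ` and so `θ` is
an equivalence, while in the latter `θⁿ = 0`»).  Here: in `X ≅ Im φʳ ⊞ Ker φʳ` one summand is zero; `Im φʳ = 0` gives `φʳ = 0`;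
`Ker φʳ = 0` makes `φʳ`, hence `φ`, a monomorphism, and monomorphic endomorphisms of bi-chain objects are invertible.
[cite: Krause2015KS, §5 Lemma 5.3 (2)] [cite: Atiyah1956, §4 Lemma 6] -/
theorem BichainCondition.isIso_or_isNilpotent (hX : BichainCondition X) (hind : Indecomposable X) (φ : End X) :
    IsIso (End.asHom φ) ∨ IsNilpotent φ := by
  obtain ⟨r₀, hr₀⟩ := hX.exists_iso_biprod_image_kernel_pow φ
  obtain ⟨i, -, -⟩ := hr₀ (r₀ + 1) (by omega)
  rcases hind.2 _ _ i with hI | hK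
  · right
    refine ⟨r₀ + 1, ?_⟩
    change End.asHom (φ ^ (r₀ + 1)) = 0
    rw [← Abelian.image.fac (End.asHom (φ ^ (r₀ + 1))), hI.eq_zero_of_tgt (Abelian.factorThruImage _), zero_comp]
  · left
    have hk : kernel.ι (End.asHom (φ ^ (r₀ + 1))) = 0 := hK.eq_zero_of_src _
    haveI : Mono (End.asHom (φ ^ (r₀ + 1))) := Abelian.mono_of_kernel_ι_eq_zero _ hk
    haveI : Mono (End.asHom φ ≫ End.asHom (φ ^ r₀)) := by
      rw [← asHom_pow_succ]
      infer_instance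
    haveI : Mono (End.asHom φ) := mono_of_mono (End.asHom φ) (End.asHom (φ ^ r₀))
    exact hX.isIso_of_mono _

/-- Unit form: every endomorphism of an indecomposable bi-chain object is a unit of `End X` or nilpotent. [cite: Krause2015KS, §5 Lemma 5.3 (2)]
[cite: Atiyah1956, §4 Lemma 6] -/
theorem BichainCondition.isUnit_or_isNilpotent (hX : BichainCondition X) (hind : Indecomposable X) (φ : End X) :
    IsUnit φ ∨ IsNilpotent φ := by
  rcases hX.isIso_or_isNilpotent hind φ with h | h
  · exact Or.inl ((isUnit_iff_isIso φ).2 h)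
  · exact Or.inr h

/-! ## §5 Prop. 5.4: for bi-chain objects, indecomposable ⟺ local endomorphism ring (Atiyah Lemmas 7–8) -/

/-- **Krause Prop. 5.4 (⟹) ∕ Atiyah's Lemma 7**: an indecomposable object satisfying the bi-chain condition has LOCAL endomorphism ring
(every non-unit of `End X` is nilpotent by §4, and a ring whose non-units are nilpotent is local — Lam (19.3), tree lemma
`isLocalRing_of_forall_not_isUnit_isNilpotent`; Krause: «`(id_X − ρφ)(id_X + ρφ + … + (ρφ)ʳ⁻¹) = id_X`»).
[cite: Krause2015KS, §5 Prop. 5.4] [cite: Atiyah1956, §4 Lemma 7] -/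
theorem BichainCondition.isLocalRing_end (hX : BichainCondition X) (hind : Indecomposable X) : IsLocalRing (End X) := by
  haveI : Nontrivial (End X) := nontrivial_of_ne 1 0 fun h10 => hind.1 ((IsZero.iff_id_eq_zero X).2 h10)
  exact Literature.RingTheory.SimpleModule.isLocalRing_of_forall_not_isUnit_isNilpotent fun φ hφ =>
    (hX.isUnit_or_isNilpotent hind φ).resolve_left hφ

/-- **Krause Prop. 5.4.** «An object satisfying the bi-chain condition is indecomposable if and only if its endomorphism ring is local.»
(⟸ holds for every object of a preadditive category: tree lemma `indecomposable_of_isLocalRing_end`.) [cite: Krause2015KS, §5 Prop. 5.4] -/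
theorem BichainCondition.indecomposable_iff_isLocalRing_end (hX : BichainCondition X) : Indecomposable X ↔ IsLocalRing (End X) :=
  ⟨hX.isLocalRing_end, fun _ => indecomposable_of_isLocalRing_end⟩

/-- **Atiyah's Lemma 8**: «Let the bi-chain condition hold in `𝔄`, and let `A ∈ 𝔄` be indecomposable. If `∑_{s=1}^m θₛ = e_A`, where
`θₛ ∈ H(A,A)`, then at least one of the `θₛ` is an equivalence» — with Lemma 7 («if `θ + φ = ω` … and `ω` is an equivalence, then at least
one of `θ, φ` is an equivalence») in the form: a sum which is an equivalence has an invertible summand; immediate from the locality of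
`End A`. [cite: Atiyah1956, §4 Lemmas 7–8] -/
theorem BichainCondition.exists_isIso_of_isIso_sum (hX : BichainCondition X) (hind : Indecomposable X) {ι : Type*} (s : Finset ι)
    (θ : ι → End X) (hω : IsIso (End.asHom (∑ i ∈ s, θ i))) : ∃ i ∈ s, IsIso (End.asHom (θ i)) := by
  haveI := hX.isLocalRing_end hind
  obtain ⟨i, hi, hu⟩ := IsLocalRing.exists_of_isUnit_sum ((isUnit_iff_isIso _).2 hω)
  exact ⟨i, hi, (isUnit_iff_isIso _).1 hu⟩

end Abelian

end Literature.CategoryTheory.KrullSchmidt
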